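import Literature.Geometry.Lorentzian.CoordRicciCovariance
import Literature.Geometry.Lorentzian.CoordRicciPerturbation
import Literature.Geometry.Lorentzian.CoordCylinderFunctional
import Literature.Geometry.Lorentzian.CoordCylinderRicci
import HarnessLib
import Literature.Geometry.Lorentzian.KerrSchildChartCovariance
import Literature.Geometry.Lorentzian.NearKerrLeaf
import Literature.Geometry.Lorentzian.KerrKretschmannScalar
import Literature.Geometry.Lorentzian.AdiabaticKerrSchildBackground

/-!
# No `C²`-quiet windowed thick Kerr collar chart exists in Minkowski space (Kretschmann exclusion)

Topic `Geometry/Lorentzian`; everything PROVED (the closed form of the Kretschmann scalar of Kerr,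
`Literature.Geometry.Lorentzian.Kerr.kretschmannScalar_closedForm` of `KerrKretschmannScalar.lean`,
enters as the hypothesis `(hQ : Kerr.kretschmannScalar_closedForm)` of the two final theorems — an
unproved NAMED FACT, so both are CONDITIONAL on it). Serves crux
`GenericCensorshipCollarMargin` (stmt-FinalStateConjecture-10809, route `BartnikGapSettling` of summit
`FinalStateConjecture`): the first `--supports` lemma of its line `hair-vacates-the-margin`
(stub `MarginWall`, "windowed junk exclusion by the Kretschmann scalar for charts of bounded boost")
and the Lean certificate that the RESTATED collar-margin clause (label window `m₀ ≤ M₁ ≤ m₀⁻¹` and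
boost window, candidate C‴ of `Cruxes/GenericCensorshipCollarMargin/RestatementProbeC3.lean`) is
junk-free in flat space — whereas the FILED clause (no window) is violated in Minkowski space by
thick collar charts of extremal label `M₁ → ∞` (Lorentzian one-sided Nash–Kuiper; crux workfile
`MisstatedByMimicry.md`, negative lemma `GenericCensorshipCollarMargin_false_of_ExtremalJunkCollars`).

## The argument (DHRT arXiv:2104.08222, §1 vocabulary; O'Neill 1983, Ch. 3 curvature calculus)

A thick Kerr collar chart `Φ₁` of a spacetime `𝓢` modelled on the boosted Kerr STAR background
`B₁ = starBackground Λ c M₁ a₁ r` (`NearKerrLeaf.lean`: components `g_B = (Λ⁻¹)ᵀ g_{M₁,a₁}(Λ⁻¹(· − c)) Λ⁻¹`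
in Kerr–Schild Cartesian coordinates) is `δ`-quiet in `C²` on its thick slab when
`truncDeviationCk B₁ Φ₁ 2 (3M₁) 0 ≤ δ` (`KerrConvergence.lean`: the unweighted `C²` sup norm of
`Φ₁^* g − g_B` over `{t* = 0, M₁ < r ≤ 3M₁}`). Take `𝓢 =` Minkowski space and the EQUATORIAL slab
point `x_e = Λ(0, √(4M₁² + a₁²), 0, 0) + c` (`r = 2M₁`, `x₃ = 0`). There:

1. the `2`-jets of `Φ₁^*η` and `g_B` are `δ`-close (`enorm_iteratedFDeriv_le_supCkENorm`; the extended
   deviation IS `Φ₁^*η − g_B` near `x_e`, `jets_deviationExtend`);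
2. `Φ₁^*η = (Dφ)ᵀ η (Dφ)` (`chartForm`, `φ` the ambient representative of `Φ₁`) is nondegenerate at
   `x_e` for small `δ` (uniformly: `exists_uniform_inverse_bound` near the compact set of background
   `0`-jets), hence `Dφ` is invertible near `x_e` and `Φ₁^*η` is the pull-back of the CONSTANT `η`
   along a change of coordinates: it is FLAT, `R = 0` (`riemAt_pullMetric_const`, naturality
   `riemAt_pullMetric_eq_conj` + O'Neill's "semi-Euclidean space is flat");
3. the `C²`-perturbation estimate for the curvature (`IsMetricOn.norm_riemAt_sub_le` of
   `CoordRicciPerturbation.lean`, Kotschwar 2014 (8)) with a flat comparison field gives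
   `‖R_B(X,Y)Z‖ ≤ 42N⁵δ‖X‖‖Y‖‖Z‖` and `|Rm|²_B(x_e) ≤ 4⁵ N² (42N⁵δ)²` (`abs_rmNormSqAt_le_of_flat_close`),
   with ONE constant `N` for the whole window (compactness of
   `{(M, a, Λ⁻¹, Λ)} ⊂ ℝ² × (E4 →L E4)²` and continuity of the jets of the background family,
   `KerrWindow.exists_jet_bound`, from the joint smoothness of `(M, a, x) ↦ g_{M,a}(x)`);
4. but `|Rm|²_B(x_e) = |Rm|²_{g_{M₁,a₁}}(y_e) = 48M₁²/(2M₁)⁶ = ¾M₁⁻⁴ ≥ ¾m₀⁴` (naturality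
   `rmNormSqAt_pullMetric` and the closed form `hQ`, Visser arXiv:0706.0622 §3) — contradiction for
   `δ ≤ δ₀(m₀, ρ₀)`.

## Main statements

* `minkowski_truncDeviationCk_gt_of_window` — `∃ δ₀ > 0`, every such chart has `C²`-deviation `> δ₀`;
* `minkowski_windowedCollarMargin_of_kretschmann` — the windowed, boost-bounded clause (C‴ body, with
  `max(‖Λ‖, ‖Λ⁻¹‖) ≤ ρ₀`) holds for Minkowski space with `χ₁ = 0`, `k₁ = 2`, `K₁ = ∅` (vacuously).

Generic by-products (namespace `MetricCoord`): finite additivity of `riemAt`, `riemAt_eq_zero_of_basis`,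
`riemAt_pullMetric_const`, the flat comparison `IsMetricOn.norm_riemAt_le_of_flat_close`, the basis
bound `abs_ginv_le_norm_sharpAt`, `abs_rmNormSqAt_le_of_riemAt_le`; and `exists_uniform_inverse_bound`
(uniform invertibility near a compact set of invertible maps). No open-embedding hypothesis on the
chart is needed anywhere. Boosts enter only through the bounds `‖Λ‖, ‖Λ⁻¹‖ ≤ ρ₀` (both are windowed;
for a Lorentz transformation the two norms agree, which is not used).

## References

* M. Dafermos, G. Holzegel, I. Rodnianski, M. Taylor, arXiv:2104.08222, §1 (near-Kerr charts). [arXiv210408222]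
* B. O'Neill, *Semi-Riemannian geometry* (1983), Ch. 3, Lemma 3.14, Prop. 3.41, Prop. 3.59. [ONeill1983]
* B. Kotschwar, Comm. Anal. Geom. 22 (2014), §1.1 (8) (curvature difference identities). [Kotschwar2014]
* M. Visser, *The Kerr spacetime: a brief introduction*, arXiv:0706.0622, §3 (Kretschmann scalar). [arXiv07060622]
* R. P. Kerr, A. Schild (1965), §3. [KerrSchild1965]
-/

noncomputable section

-- instance search through nested operator types (as in `CoordCurvature`)
set_option maxSynthPendingDepth 3

open Set Function Filter ContinuousLinearMap Metric
open scoped Topology Manifold ContDiff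

namespace Literature.Geometry.Lorentzian.MetricCoord

variable {E : Type*} [NormedAddCommGroup E] [InnerProductSpace ℝ E]

variable [FiniteDimensional ℝ E] [CompleteSpace E]

omit [FiniteDimensional ℝ E] [CompleteSpace E] in
/-- `R(Σᵢ Xᵢ, Y) = Σᵢ R(Xᵢ, Y)` (finite additivity in the first slot). [folklore] -/
theorem riemAt_sum_left {ι : Type*} (G : E → E →L[ℝ] E →L[ℝ] ℝ) (x : E) (s : Finset ι)
    (f : ι → E) (Y : E) : riemAt G x (∑ i ∈ s, f i) Y = ∑ i ∈ s, riemAt G x (f i) Y := by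
  classical
  induction s using Finset.induction_on with
  | empty =>
    simp only [Finset.sum_empty]
    have := riemAt_smul_left (G := G) x (0 : ℝ) (0 : E) Y
    simpa using this
  | insert a s ha ih => rw [Finset.sum_insert ha, Finset.sum_insert ha, riemAt_add_left, ih]

omit [FiniteDimensional ℝ E] [CompleteSpace E] in
/-- `R(X, Σⱼ Yⱼ) = Σⱼ R(X, Yⱼ)` (finite additivity in the second slot). [folklore] -/
theorem riemAt_sum_right {ι : Type*} (G : E → E →L[ℝ] E →L[ℝ] ℝ) (x : E) (s : Finset ι)
    (X : E) (f : ι → E) : riemAt G x X (∑ i ∈ s, f i) = ∑ i ∈ s, riemAt G x X (f i) := by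
  classical
  induction s using Finset.induction_on with
  | empty =>
    simp only [Finset.sum_empty]
    have := riemAt_smul_right (G := G) x (0 : ℝ) X (0 : E)
    simpa using this
  | insert a s ha ih => rw [Finset.sum_insert ha, Finset.sum_insert ha, riemAt_add_right, ih]

omit [FiniteDimensional ℝ E] [CompleteSpace E] in
/-- **Curvature endomorphisms vanishing on a basis vanish**: if `R(b_j, b_k) = 0` for all `j, k`
then `R(X, Y) = 0` for all `X, Y` (bilinearity). [folklore] -/
theorem riemAt_eq_zero_of_basis {ι : Type*} [Fintype ι] (b : Module.Basis ι ℝ E)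
    {G : E → E →L[ℝ] E →L[ℝ] ℝ} {x : E} (h : ∀ j k, riemAt G x (b j) (b k) = 0) (X Y : E) :
    riemAt G x X Y = 0 := by
  conv_lhs => rw [← b.sum_repr X, ← b.sum_repr Y]
  rw [riemAt_sum_left]
  refine Finset.sum_eq_zero fun j _ ↦ ?_
  rw [riemAt_smul_left, riemAt_sum_right]
  rw [Finset.sum_eq_zero fun k _ ↦ ?_, smul_zero]
  rw [riemAt_smul_right, h j k, smul_zero]

/-- **A pull-back of constant (flat) components along a change of coordinates is flat**: the
curvature endomorphisms of `ψ^* B` vanish at every point of the coordinate domain (naturality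
`riemAt_pullMetric_eq_conj` and `riemAt_const`). O'Neill 1983, Ch. 3, Prop. 3.59 with Prop. 3.41.
[cite: ONeill1983, Ch. 3, Prop. 3.59] -/
theorem riemAt_pullMetric_const {B : E →L[ℝ] E →L[ℝ] ℝ} {V V' : Set E} {ψ : E → E} {y : E}
    (hB : IsMetricOn (fun _ : E ↦ B) V) (hψ : IsCoordChangeOn ψ V' V) (hy : y ∈ V') (X Y : E) :
    riemAt (pullMetric (fun _ : E ↦ B) ψ) y X Y = 0 := by
  obtain ⟨D, hD⟩ := hψ.isInvertible y hy
  refine riemAt_eq_zero_of_basis (Module.finBasis ℝ E) (fun j k ↦ ?_) X Y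
  rw [riemAt_pullMetric_eq_conj (Module.finBasis ℝ E) hB hψ hy hD j k]
  have h0 : riemAt (fun _ : E ↦ B) (ψ y) (D ((Module.finBasis ℝ E) j)) (D ((Module.finBasis ℝ E) k)) = 0 := by
    ext Z
    rw [riemAt_const]
    rfl
  rw [h0]
  simp

/-! ### The flat comparison: `C²`-close to flat forces small curvature -/

omit [FiniteDimensional ℝ E] in
/-- **Flat comparison.** Let `G` (background) and `G'` (a FLAT field, `R' = 0` at `x`) be metric
components on `V ∋ x` with the common bounds `‖♯‖, ‖♯'‖, ‖DG‖, ‖DG'‖, ‖D²G‖ ≤ N`, `N ≥ 1`, and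
`C²`-close jets at `x`: `‖G − G'‖, ‖DG − DG'‖, ‖D²G − D²G'‖ ≤ δ` there. Then the curvature of the
BACKGROUND is small: `‖R(X,Y)Z‖ ≤ 42 N⁵ δ ‖X‖‖Y‖‖Z‖` (`norm_riemAt_sub_le` with `R' = 0` and
`‖♯ − ♯'‖ ≤ ‖♯‖‖G − G'‖‖♯'‖ ≤ N²δ`). [cite: Kotschwar2014, §1.1 (8)] -/
theorem IsMetricOn.norm_riemAt_le_of_flat_close {G G' : E → E →L[ℝ] E →L[ℝ] ℝ} {V : Set E}
    {x : E} (hG : IsMetricOn G V) (hG' : IsMetricOn G' V) (hx : x ∈ V) {N δ : ℝ} (hN : 1 ≤ N)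
    (hδ : 0 ≤ δ) (hs : ‖sharpAt G x‖ ≤ N) (hs' : ‖sharpAt G' x‖ ≤ N) (h1 : ‖fderiv ℝ G x‖ ≤ N)
    (h1' : ‖fderiv ℝ G' x‖ ≤ N) (h2 : ‖fderiv ℝ (fderiv ℝ G) x‖ ≤ N)
    (hflat : ∀ X Y Z : E, riemAt G' x X Y Z = 0)
    (hd0 : ‖G x - G' x‖ ≤ δ) (hd1 : ‖fderiv ℝ G x - fderiv ℝ G' x‖ ≤ δ)
    (hd2 : ‖fderiv ℝ (fderiv ℝ G) x - fderiv ℝ (fderiv ℝ G') x‖ ≤ δ) (X Y Z : E) :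
    ‖riemAt G x X Y Z‖ ≤ 42 * N ^ 5 * δ * ‖X‖ * ‖Y‖ * ‖Z‖ := by
  have hN0 : 0 ≤ N := zero_le_one.trans hN
  have hsharp : ‖sharpAt G x - sharpAt G' x‖ ≤ N ^ 2 * δ := by
    have h := norm_sharpAt_sub_le (hG.isInvertible x hx) (hG'.isInvertible x hx)
    calc _ ≤ ‖sharpAt G x‖ * ‖G x - G' x‖ * ‖sharpAt G' x‖ := h
      _ ≤ N * δ * N := by gcongr
      _ = N ^ 2 * δ := by ring
  have hmain := hG.norm_riemAt_sub_le hG' hx hN hs hs' h1 h1' h2 X Y Z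
  rw [hflat X Y Z, sub_zero] at hmain
  have hN1 : (1 : ℝ) ≤ N ^ 2 := one_le_pow₀ hN
  calc ‖riemAt G x X Y Z‖ ≤ N ^ 3 * (21 * ‖sharpAt G x - sharpAt G' x‖
        + 18 * ‖fderiv ℝ G x - fderiv ℝ G' x‖
        + 3 * ‖fderiv ℝ (fderiv ℝ G) x - fderiv ℝ (fderiv ℝ G') x‖) * ‖X‖ * ‖Y‖ * ‖Z‖ := hmain
    _ ≤ N ^ 3 * (21 * (N ^ 2 * δ) + 18 * (N ^ 2 * δ) + 3 * (N ^ 2 * δ)) * ‖X‖ * ‖Y‖ * ‖Z‖ := by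
        gcongr
        · calc ‖fderiv ℝ G x - fderiv ℝ G' x‖ ≤ δ := hd1
            _ = 1 * δ := (one_mul δ).symm
            _ ≤ N ^ 2 * δ := by gcongr
        · calc ‖fderiv ℝ (fderiv ℝ G) x - fderiv ℝ (fderiv ℝ G') x‖ ≤ δ := hd2
            _ = 1 * δ := (one_mul δ).symm
            _ ≤ N ^ 2 * δ := by gcongr
    _ = 42 * N ^ 5 * δ * ‖X‖ * ‖Y‖ * ‖Z‖ := by ring

/-! ### From a Riemann bound to a Kretschmann bound, in an orthonormal basis -/

omit [CompleteSpace E] in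
/-- In an ORTHONORMAL basis the inverse-metric coefficients are bounded by the norm of `♯`:
`|g^{ij}| = |⟪e_i, ♯ e^j⟫| ≤ ‖♯‖`. [folklore] -/
theorem abs_ginv_le_norm_sharpAt {ι : Type*} [Fintype ι] (e : OrthonormalBasis ι ℝ E)
    (G : E → E →L[ℝ] E →L[ℝ] ℝ) (x : E) (i j : ι) :
    |ginv G e.toBasis x i j| ≤ ‖sharpAt G x‖ := by
  unfold ginv
  rw [Module.Basis.coord_apply, OrthonormalBasis.coe_toBasis_repr_apply, e.repr_apply_apply]
  have hc : ‖coordCLM e.toBasis j‖ ≤ 1 := by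
    refine ContinuousLinearMap.opNorm_le_bound _ zero_le_one fun w ↦ ?_
    rw [coordCLM_apply, Module.Basis.coord_apply, OrthonormalBasis.coe_toBasis_repr_apply,
      e.repr_apply_apply, one_mul]
    simpa using abs_real_inner_le_norm (e j) w
  refine (abs_real_inner_le_norm _ _).trans ?_
  calc ‖e i‖ * ‖sharpAt G x (coordCLM e.toBasis j)‖
      = ‖sharpAt G x (coordCLM e.toBasis j)‖ := by rw [e.orthonormal.1 i, one_mul]
    _ ≤ ‖sharpAt G x‖ * ‖coordCLM e.toBasis j‖ := le_opNorm _ _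
    _ ≤ ‖sharpAt G x‖ * 1 := by gcongr
    _ = ‖sharpAt G x‖ := mul_one _

omit [CompleteSpace E] in
/-- **From a bound on the curvature endomorphisms to a bound on `|Rm|²`**: in an orthonormal basis
of an `n`-dimensional space, if `‖R(X,Y)Z‖ ≤ ρ‖X‖‖Y‖‖Z‖` and `‖♯‖ ≤ s` at `x` then
`|Σ g g tr(RR)| ≤ n⁴ · s² · (n ρ²)`, i.e. `|rmNormSqAt G x| ≤ n⁵ s² ρ²` (`rmNormSqAt_eq_sum`,
`|tr T| ≤ n‖T‖`). [folklore] -/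
theorem abs_rmNormSqAt_le_of_riemAt_le {ι : Type*} [Fintype ι] (e : OrthonormalBasis ι ℝ E)
    {G : E → E →L[ℝ] E →L[ℝ] ℝ} {x : E} {ρ s : ℝ} (hρ : 0 ≤ ρ) (hs : ‖sharpAt G x‖ ≤ s)
    (hR : ∀ X Y Z : E, ‖riemAt G x X Y Z‖ ≤ ρ * ‖X‖ * ‖Y‖ * ‖Z‖) :
    |rmNormSqAt G x| ≤ (Fintype.card ι : ℝ) ^ 4 * s ^ 2 * (Module.finrank ℝ E * ρ ^ 2) := by
  have hs0 : 0 ≤ s := (norm_nonneg _).trans hs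
  have hRop : ∀ a c, ‖riemAt G x (e a) (e c)‖ ≤ ρ := fun a c ↦ by
    refine ContinuousLinearMap.opNorm_le_bound _ hρ fun Z ↦ ?_
    have h := hR (e a) (e c) Z
    rw [e.orthonormal.1 a, e.orthonormal.1 c, mul_one, mul_one] at h
    exact h
  have hterm : ∀ a a' c c', |ginv G e.toBasis x a a' * ginv G e.toBasis x c c' *
      traceCLM E ((riemAt G x (e.toBasis a) (e.toBasis c)).comp
        (riemAt G x (e.toBasis a') (e.toBasis c')))| ≤ s * s * (Module.finrank ℝ E * ρ ^ 2) := by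
    intro a a' c c'
    rw [abs_mul, abs_mul]
    have hg1 := (abs_ginv_le_norm_sharpAt e G x a a').trans hs
    have hg2 := (abs_ginv_le_norm_sharpAt e G x c c').trans hs
    have htr : |traceCLM E ((riemAt G x (e.toBasis a) (e.toBasis c)).comp
        (riemAt G x (e.toBasis a') (e.toBasis c')))| ≤ Module.finrank ℝ E * ρ ^ 2 := by
      refine (abs_traceCLM_le_finrank_mul_norm _).trans ?_
      gcongr
      rw [OrthonormalBasis.coe_toBasis]
      calc ‖(riemAt G x (e a) (e c)).comp (riemAt G x (e a') (e c'))‖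
          ≤ ‖riemAt G x (e a) (e c)‖ * ‖riemAt G x (e a') (e c')‖ := opNorm_comp_le _ _
        _ ≤ ρ * ρ := mul_le_mul (hRop a c) (hRop a' c') (norm_nonneg _) hρ
        _ = ρ ^ 2 := (sq ρ).symm
    have h0 : 0 ≤ |ginv G e.toBasis x a a'| := abs_nonneg _
    have h1 : 0 ≤ |ginv G e.toBasis x c c'| := abs_nonneg _
    exact mul_le_mul (mul_le_mul hg1 hg2 h1 hs0) htr (abs_nonneg _) (by positivity)
  rw [rmNormSqAt_eq_sum e.toBasis, abs_neg]
  calc _ ≤ ∑ a, ∑ a', ∑ c, ∑ c', s * s * (Module.finrank ℝ E * ρ ^ 2) := by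
        refine (Finset.abs_sum_le_sum_abs _ _).trans (Finset.sum_le_sum fun a _ ↦ ?_)
        refine (Finset.abs_sum_le_sum_abs _ _).trans (Finset.sum_le_sum fun a' _ ↦ ?_)
        refine (Finset.abs_sum_le_sum_abs _ _).trans (Finset.sum_le_sum fun c _ ↦ ?_)
        exact (Finset.abs_sum_le_sum_abs _ _).trans (Finset.sum_le_sum fun c' _ ↦ hterm a a' c c')
    _ = (Fintype.card ι : ℝ) ^ 4 * s ^ 2 * (Module.finrank ℝ E * ρ ^ 2) := by
        simp only [Finset.sum_const, Finset.card_univ, nsmul_eq_mul]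
        ring

/-- **`C²`-close to flat ⇒ small Kretschmann** (the two previous lemmas combined): under the
hypotheses of `norm_riemAt_le_of_flat_close`, `|rmNormSqAt G x| ≤ n⁵ N² (42 N⁵ δ)²`.
[cite: Kotschwar2014, §1.1 (8)] -/
theorem IsMetricOn.abs_rmNormSqAt_le_of_flat_close {ι : Type*} [Fintype ι] (e : OrthonormalBasis ι ℝ E)
    {G G' : E → E →L[ℝ] E →L[ℝ] ℝ} {V : Set E}
    {x : E} (hG : IsMetricOn G V) (hG' : IsMetricOn G' V) (hx : x ∈ V) {N δ : ℝ} (hN : 1 ≤ N)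
    (hδ : 0 ≤ δ) (hs : ‖sharpAt G x‖ ≤ N) (hs' : ‖sharpAt G' x‖ ≤ N) (h1 : ‖fderiv ℝ G x‖ ≤ N)
    (h1' : ‖fderiv ℝ G' x‖ ≤ N) (h2 : ‖fderiv ℝ (fderiv ℝ G) x‖ ≤ N)
    (hflat : ∀ X Y Z : E, riemAt G' x X Y Z = 0)
    (hd0 : ‖G x - G' x‖ ≤ δ) (hd1 : ‖fderiv ℝ G x - fderiv ℝ G' x‖ ≤ δ)
    (hd2 : ‖fderiv ℝ (fderiv ℝ G) x - fderiv ℝ (fderiv ℝ G') x‖ ≤ δ) :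
    |rmNormSqAt G x| ≤
      (Fintype.card ι : ℝ) ^ 4 * N ^ 2 * (Module.finrank ℝ E * (42 * N ^ 5 * δ) ^ 2) := by
  have hN0 : 0 ≤ N := zero_le_one.trans hN
  refine abs_rmNormSqAt_le_of_riemAt_le e (by positivity) hs fun X Y Z ↦ ?_
  exact hG.norm_riemAt_le_of_flat_close hG' hx hN hδ hs hs' h1 h1' h2 hflat hd0 hd1 hd2 X Y Z

end Literature.Geometry.Lorentzian.MetricCoord

namespace Literature.Geometry.Lorentzian

/-- Shortcut: the space of bilinear forms on `E4` is a normed group (canonical instance). [folklore] -/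
local instance instNormedAddCommGroupBilinE4' : NormedAddCommGroup (E4 →L[ℝ] E4 →L[ℝ] ℝ) :=
  ContinuousLinearMap.toNormedAddCommGroup

/-- Shortcut: the space of bilinear forms on `E4` is a normed space (canonical instance). [folklore] -/
local instance instNormedSpaceBilinE4' : NormedSpace ℝ (E4 →L[ℝ] E4 →L[ℝ] ℝ) :=
  ContinuousLinearMap.toNormedSpace

/-! ### Uniform invertibility near a compact set of invertible maps -/

namespace KerrWindow

section UniformInverse

variable {F G : Type*} [NormedAddCommGroup F] [NormedSpace ℝ F] [NormedAddCommGroup G] [NormedSpace ℝ G]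
  [CompleteSpace F]

/-- The invertible continuous linear maps form an open set (range of the equivalences,
`ContinuousLinearEquiv.isOpen`). [folklore] -/
theorem isOpen_setOf_isInvertible : IsOpen {A : F →L[ℝ] G | A.IsInvertible} := by
  have h : {A : F →L[ℝ] G | A.IsInvertible} = range ((↑) : (F ≃L[ℝ] G) → F →L[ℝ] G) := by
    ext A; exact ⟨fun ⟨e, he⟩ ↦ ⟨e, he⟩, fun ⟨e, he⟩ ↦ ⟨e, he⟩⟩
  rw [h]
  exact ContinuousLinearEquiv.isOpen

/-- `A ↦ A⁻¹` is continuous on the invertible maps. [folklore] -/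
theorem continuousOn_inverse : ContinuousOn (ContinuousLinearMap.inverse : (F →L[ℝ] G) → G →L[ℝ] F)
    {A : F →L[ℝ] G | A.IsInvertible} := fun _ hA ↦
  (ContinuousLinearMap.IsInvertible.contDiffAt_map_inverse (n := 0) hA).continuousAt.continuousWithinAt

/-- **Uniform invertibility near a compact set of invertible maps**: for a compact set `K` of
invertible continuous linear maps (in a proper space of maps) there are `δ > 0` and `C` such that
every `B` within `δ` of some `A ∈ K` is invertible with `‖B⁻¹‖ ≤ C` (openness of invertibility,
continuity of the inverse, uniform continuity on a compact thickening). [folklore] -/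
theorem exists_uniform_inverse_bound [ProperSpace (F →L[ℝ] G)] {K : Set (F →L[ℝ] G)}
    (hK : IsCompact K) (hinv : ∀ A ∈ K, A.IsInvertible) :
    ∃ δ : ℝ, 0 < δ ∧ ∃ C : ℝ, ∀ A ∈ K, ∀ B : F →L[ℝ] G, ‖B - A‖ ≤ δ →
      B.IsInvertible ∧ ‖B.inverse‖ ≤ C := by
  set U := {A : F →L[ℝ] G | A.IsInvertible} with hU
  have hKU : K ⊆ U := hinv
  obtain ⟨δ₁, hδ₁, hK'U⟩ := hK.exists_cthickening_subset_open isOpen_setOf_isInvertible hKU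
  have hK' : IsCompact (Metric.cthickening δ₁ K) := hK.cthickening
  have huc := hK'.uniformContinuousOn_of_continuous (continuousOn_inverse.mono hK'U)
  obtain ⟨δ₂, hδ₂, hδ₂'⟩ := Metric.uniformContinuousOn_iff.1 huc 1 one_pos
  obtain ⟨C₀, hC₀⟩ := hK.exists_bound_of_continuousOn (continuousOn_inverse.mono hKU)
  refine ⟨min δ₁ (δ₂ / 2), lt_min hδ₁ (by positivity), C₀ + 1, fun A hA B hB ↦ ?_⟩
  have hBK' : B ∈ Metric.cthickening δ₁ K :=
    Metric.mem_cthickening_of_dist_le B A δ₁ K hA (by rw [dist_eq_norm]; exact hB.trans (min_le_left _ _))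
  have hAK' : A ∈ Metric.cthickening δ₁ K := Metric.self_subset_cthickening K hA
  refine ⟨hK'U hBK', ?_⟩
  have hd : dist B A < δ₂ := by
    rw [dist_eq_norm]
    exact hB.trans_lt ((min_le_right _ _).trans_lt (by linarith))
  have h1 : dist (ContinuousLinearMap.inverse B) (ContinuousLinearMap.inverse A) < 1 := hδ₂' B hBK' A hAK' hd
  rw [dist_eq_norm] at h1
  calc ‖B.inverse‖ = ‖(B.inverse - A.inverse) + A.inverse‖ := by rw [sub_add_cancel]
    _ ≤ ‖B.inverse - A.inverse‖ + ‖A.inverse‖ := norm_add_le _ _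
    _ ≤ 1 + C₀ := add_le_add h1.le (hC₀ A hA)
    _ = C₀ + 1 := add_comm _ _

end UniformInverse

end KerrWindow

namespace KerrWindow

/-! ### Joint smoothness of the Kerr–Schild form in `(M, a, x)` (composition form) -/

/-- **The Kerr–Schild components `g_{M,a}(x) = η + 2H ℓ⊗ℓ` are jointly `C^n` in `(M, a, x)`
wherever `r > 0`** (composition form: `q ↦ g_{M(q),a(q)}(g q)` is `C^n` at `p`; from the tree's
`Kerr.contDiffAt_scalarH_comp`, `Kerr.contDiffAt_nullCovectorFun_comp`). Kerr–Schild 1965, §3;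
Visser arXiv:0706.0622, (32)–(35). [cite: KerrSchild1965, §3] -/
theorem contDiffAt_kerrBilin_comp {F : Type*} [NormedAddCommGroup F] [NormedSpace ℝ F]
    {fM fa : F → ℝ} {g : F → E4} {p : F} {n : WithTop ℕ∞}
    (hM : ContDiffAt ℝ n fM p) (ha : ContDiffAt ℝ n fa p) (hg : ContDiffAt ℝ n g p)
    (h : 0 < Kerr.radius (fa p) (g p)) :
    ContDiffAt ℝ n (fun q ↦ Kerr.bilin (fM q) (fa q) (g q)) p := by
  have hl : ContDiffAt ℝ n (fun q ↦ Kerr.nullCovector (fa q) (g q)) p := by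
    have : (fun q ↦ Kerr.nullCovector (fa q) (g q)) =
        fun q ↦ ∑ μ, Kerr.nullCovectorFun (fa q) (g q) μ • E4.dx μ := rfl
    rw [this]
    exact ContDiffAt.sum fun μ _ ↦ (Kerr.contDiffAt_nullCovectorFun_comp ha hg h μ).smul contDiffAt_const
  have hH : ContDiffAt ℝ n (fun q ↦ Kerr.scalarH (fM q) (fa q) (g q)) p :=
    Kerr.contDiffAt_scalarH_comp hM ha hg h
  have heq : (fun q ↦ Kerr.bilin (fM q) (fa q) (g q)) = fun q ↦ Minkowski.bilin +
      E4.tmul ((2 * Kerr.scalarH (fM q) (fa q) (g q)) • Kerr.nullCovector (fa q) (g q))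
        (Kerr.nullCovector (fa q) (g q)) := by
    funext q
    rw [Kerr.bilin_eq_fun]
  rw [heq]
  exact contDiffAt_const.add (((contDiffAt_const.mul hH).smul hl).smulRight hl)

/-! ### The equatorial comparison point `y_e(M, a) = (0, √(4M² + a²), 0, 0)`: `r = 2M`, `x₃ = 0` -/

/-- The rest-frame equatorial point `y_e(M,a) = √(4M² + a²) · ∂₁`. [folklore] -/
def eqPoint (M a : ℝ) : E4 := Real.sqrt (4 * M ^ 2 + a ^ 2) • EuclideanSpace.single (1 : Fin 4) (1 : ℝ)

/-- Coordinates of the equatorial point. [folklore] -/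
theorem eqPoint_apply (M a : ℝ) (μ : Fin 4) :
    eqPoint M a μ = if μ = 1 then Real.sqrt (4 * M ^ 2 + a ^ 2) else 0 := by
  simp only [eqPoint, PiLp.smul_apply, PiLp.single_apply, smul_eq_mul, mul_ite, mul_one, mul_zero]

/-- The equatorial point has `x₃ = 0`. [folklore] -/
theorem eqPoint_three (M a : ℝ) : eqPoint M a 3 = 0 := by
  rw [eqPoint_apply]; simp

/-- The equatorial point has `t = 0`. [folklore] -/
theorem eqPoint_zero (M a : ℝ) : eqPoint M a 0 = 0 := by
  rw [eqPoint_apply]; simp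

/-- `ρ² = 4M² + a²` at the equatorial point. [folklore] -/
theorem spatialNorm_sq_eqPoint (M a : ℝ) : E4.spatialNorm (eqPoint M a) ^ 2 = 4 * M ^ 2 + a ^ 2 := by
  rw [E4.spatialNorm_sq, eqPoint_apply, eqPoint_apply, eqPoint_apply]
  simp only [Fin.isValue, ↓reduceIte, Fin.reduceEq]
  rw [Real.sq_sqrt (by positivity)]
  ring

/-- **`r(y_e) = 2M`** for `M ≥ 0` (Visser's quartic with `z = 0`: `r² = ρ² − a²`). [cite: arXiv07060622, (35)] -/
theorem radius_eqPoint {M : ℝ} (hM : 0 ≤ M) (a : ℝ) : Kerr.radius a (eqPoint M a) = 2 * M := by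
  unfold Kerr.radius
  rw [spatialNorm_sq_eqPoint, eqPoint_three]
  have h1 : 4 * M ^ 2 + a ^ 2 - a ^ 2 = 4 * M ^ 2 := by ring
  rw [h1]
  have h2 : (4 * M ^ 2) ^ 2 + 4 * a ^ 2 * (0 : ℝ) ^ 2 = (4 * M ^ 2) ^ 2 := by ring
  rw [h2, Real.sqrt_sq (by positivity)]
  have h3 : (4 * M ^ 2 + 4 * M ^ 2) / 2 = (2 * M) ^ 2 := by ring
  rw [h3, Real.sqrt_sq (by positivity)]

/-- `(M, a) ↦ y_e(M, a)` is smooth where `4M² + a² > 0`. [folklore] -/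
theorem contDiffAt_eqPoint {q : ℝ × ℝ} (hq : 0 < 4 * q.1 ^ 2 + q.2 ^ 2) {n : WithTop ℕ∞} :
    ContDiffAt ℝ n (fun q : ℝ × ℝ ↦ eqPoint q.1 q.2) q := by
  unfold eqPoint
  have h1 : ContDiffAt ℝ n (fun q : ℝ × ℝ ↦ Real.sqrt (4 * q.1 ^ 2 + q.2 ^ 2)) q :=
    ((contDiffAt_const.mul (contDiffAt_fst.pow 2)).add (contDiffAt_snd.pow 2)).sqrt hq.ne'
  exact h1.smul (contDiffAt_const (c := EuclideanSpace.single (1 : Fin 4) (1 : ℝ)))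

/-! ### The parameter family `G_p(x) = Sᵀ g_{M,a}(S x) S` and its compact parameter set -/

/-- The parameter type: `(M, a, S, T)` — mass, spin, the linear part `S = Λ⁻¹` of the rest-frame
map and its inverse `T = Λ`. [folklore] -/
abbrev Param : Type := ℝ × ℝ × (E4 →L[ℝ] E4) × (E4 →L[ℝ] E4)

/-- The conjugated Kerr–Schild components `G_p(x)(v, w) = g_{M,a}(S x)(S v, S w)`. [cite: KerrSchild1965] -/
def fam (p : Param) (x : E4) : E4 →L[ℝ] E4 →L[ℝ] ℝ :=
  (ContinuousLinearMap.precomp ℝ p.2.2.1).comp ((Kerr.bilin p.1 p.2.1 (p.2.2.1 x)).comp p.2.2.1)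

/-- Unfolding lemma for `fam`. [folklore] -/
theorem fam_apply (p : Param) (x v w : E4) :
    fam p x v w = Kerr.bilin p.1 p.2.1 (p.2.2.1 x) (p.2.2.1 v) (p.2.2.1 w) := rfl

/-- **Joint smoothness of `(p, x) ↦ G_p(x)`** wherever `r_{a}(S x) > 0` (the Kerr–Schild form is
jointly smooth in `(M, a, x)` off `{r = 0}`, `Kerr.contDiffAt_bilin₃`; evaluation and composition of
continuous linear maps are smooth). [cite: KerrSchild1965, §3] -/
theorem contDiffAt_fam {q : Param × E4} (hq : 0 < Kerr.radius q.1.2.1 (q.1.2.2.1 q.2)) {n : WithTop ℕ∞} :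
    ContDiffAt ℝ n (fun q : Param × E4 ↦ fam q.1 q.2) q := by
  -- `(p, x) ↦ (M, a, S x)`
  have hS : ContDiff ℝ n (fun q : Param × E4 ↦ q.1.2.2.1) := by fun_prop
  have hSx : ContDiff ℝ n (fun q : Param × E4 ↦ q.1.2.2.1 q.2) := hS.clm_apply contDiff_snd
  have hK : ContDiffAt ℝ n (fun q : Param × E4 ↦ Kerr.bilin q.1.1 q.1.2.1 (q.1.2.2.1 q.2)) q :=
    contDiffAt_kerrBilin_comp contDiffAt_fst.fst contDiffAt_fst.snd.fst hSx.contDiffAt hq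
  have hpre : ContDiffAt ℝ n (fun q : Param × E4 ↦ ContinuousLinearMap.precomp ℝ q.1.2.2.1 :
      Param × E4 → (E4 →L[ℝ] ℝ) →L[ℝ] E4 →L[ℝ] ℝ) q :=
    contMDiffAt_iff_contDiffAt.1 ((contMDiffAt_iff_contDiffAt.2 hS.contDiffAt).clm_precomp (F₃ := ℝ))
  unfold fam
  exact hpre.clm_comp (hK.clm_comp hS.contDiffAt)

/-! ### The compact parameter set of the window -/

/-- **The windowed parameter set**: masses `m₀ ≤ M ≤ m₀⁻¹`, spins `|a| ≤ M`, and mutually inverse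
linear parts `S = Λ⁻¹`, `T = Λ` of operator norm `≤ ρ₀`. [folklore] -/
def paramSet (m₀ ρ₀ : ℝ) : Set Param :=
  {p | m₀ ≤ p.1 ∧ p.1 ≤ m₀⁻¹ ∧ |p.2.1| ≤ p.1 ∧ ‖p.2.2.1‖ ≤ ρ₀ ∧ ‖p.2.2.2‖ ≤ ρ₀ ∧
    p.2.2.1.comp p.2.2.2 = ContinuousLinearMap.id ℝ E4 ∧
    p.2.2.2.comp p.2.2.1 = ContinuousLinearMap.id ℝ E4}

/-- The windowed parameter set is closed. [folklore] -/
theorem isClosed_paramSet (m₀ ρ₀ : ℝ) : IsClosed (paramSet m₀ ρ₀) := by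
  have h1 : Continuous fun p : Param ↦ p.1 := by fun_prop
  have h2 : Continuous fun p : Param ↦ p.2.1 := by fun_prop
  have h3 : Continuous fun p : Param ↦ p.2.2.1 := by fun_prop
  have h4 : Continuous fun p : Param ↦ p.2.2.2 := by fun_prop
  refine (isClosed_le continuous_const h1).inter ((isClosed_le h1 continuous_const).inter
    ((isClosed_le (continuous_abs.comp h2) h1).inter ((isClosed_le h3.norm continuous_const).inter
    ((isClosed_le h4.norm continuous_const).inter ((isClosed_eq (h3.clm_comp h4) continuous_const).inter
    (isClosed_eq (h4.clm_comp h3) continuous_const))))))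

/-- The windowed parameter set is bounded. [folklore] -/
theorem isBounded_paramSet (m₀ ρ₀ : ℝ) : Bornology.IsBounded (paramSet m₀ ρ₀) := by
  rw [Metric.isBounded_iff_subset_closedBall (0 : Param)]
  refine ⟨max (max m₀⁻¹ ρ₀) 0, fun p hp ↦ ?_⟩
  obtain ⟨h1, h2, h3, h4, h5, -, -⟩ := hp
  rw [Metric.mem_closedBall, dist_zero_right]
  have hM0 : 0 ≤ p.1 := (abs_nonneg _).trans h3
  have hM : ‖p.1‖ ≤ max (max m₀⁻¹ ρ₀) 0 := by
    rw [Real.norm_of_nonneg hM0]; exact h2.trans ((le_max_left _ _).trans (le_max_left _ _))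
  have ha : ‖p.2.1‖ ≤ max (max m₀⁻¹ ρ₀) 0 := by
    rw [Real.norm_eq_abs]; exact (h3.trans h2).trans ((le_max_left _ _).trans (le_max_left _ _))
  have hS : ‖p.2.2.1‖ ≤ max (max m₀⁻¹ ρ₀) 0 := h4.trans ((le_max_right _ _).trans (le_max_left _ _))
  have hT : ‖p.2.2.2‖ ≤ max (max m₀⁻¹ ρ₀) 0 := h5.trans ((le_max_right _ _).trans (le_max_left _ _))
  simp only [Prod.norm_def, max_le_iff]
  exact ⟨hM, ha, hS, hT⟩

/-- **The windowed parameter set is compact** (closed and bounded in a finite-dimensional space).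
[folklore] -/
theorem isCompact_paramSet (m₀ ρ₀ : ℝ) : IsCompact (paramSet m₀ ρ₀) :=
  Metric.isCompact_of_isClosed_isBounded (isClosed_paramSet m₀ ρ₀) (isBounded_paramSet m₀ ρ₀)

/-! ### The comparison point in the boosted frame and the jets there -/

/-- The comparison point `x_p = T y_e(M, a)` (so that `S x_p = y_e`). [folklore] -/
def pt (p : Param) : E4 := p.2.2.2 (eqPoint p.1 p.2.1)

/-- `S x_p = y_e`. [folklore] -/
theorem apply_pt_of_mem {m₀ ρ₀ : ℝ} {p : Param} (hp : p ∈ paramSet m₀ ρ₀) :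
    p.2.2.1 (pt p) = eqPoint p.1 p.2.1 := by
  obtain ⟨-, -, -, -, -, hST, -⟩ := hp
  show (p.2.2.1.comp p.2.2.2) (eqPoint p.1 p.2.1) = _
  rw [hST]
  rfl

/-- Windowed masses are positive. [folklore] -/
theorem mass_pos_of_mem {m₀ ρ₀ : ℝ} (hm₀ : 0 < m₀) {p : Param} (hp : p ∈ paramSet m₀ ρ₀) : 0 < p.1 :=
  hm₀.trans_le hp.1

/-- `r(S x_p) = 2M`. [folklore] -/
theorem radius_pt_of_mem {m₀ ρ₀ : ℝ} (hm₀ : 0 < m₀) {p : Param} (hp : p ∈ paramSet m₀ ρ₀) :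
    Kerr.radius p.2.1 (p.2.2.1 (pt p)) = 2 * p.1 := by
  rw [apply_pt_of_mem hp, radius_eqPoint (mass_pos_of_mem hm₀ hp).le]

/-- `r(S x_p) > 0`. [folklore] -/
theorem radius_pt_pos_of_mem {m₀ ρ₀ : ℝ} (hm₀ : 0 < m₀) {p : Param} (hp : p ∈ paramSet m₀ ρ₀) :
    0 < Kerr.radius p.2.1 (p.2.2.1 (pt p)) := by
  rw [radius_pt_of_mem hm₀ hp]; exact mul_pos two_pos (mass_pos_of_mem hm₀ hp)

/-- `p ↦ x_p` is smooth at windowed parameters. [folklore] -/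
theorem contDiff_pt {n : WithTop ℕ∞} {m₀ ρ₀ : ℝ} (hm₀ : 0 < m₀) {p : Param} (hp : p ∈ paramSet m₀ ρ₀) :
    ContDiffAt ℝ n pt p := by
  have hT : ContDiffAt ℝ n (fun p : Param ↦ p.2.2.2) p := by fun_prop
  have hM := mass_pos_of_mem hm₀ hp
  have hq : 0 < 4 * (p.1, p.2.1).1 ^ 2 + (p.1, p.2.1).2 ^ 2 := by
    show 0 < 4 * p.1 ^ 2 + p.2.1 ^ 2
    positivity
  have he : ContDiffAt ℝ n (fun p : Param ↦ eqPoint p.1 p.2.1) p :=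
    ContDiffAt.comp p (g := fun q : ℝ × ℝ ↦ eqPoint q.1 q.2) (f := fun p : Param ↦ (p.1, p.2.1))
      (contDiffAt_eqPoint hq) (contDiffAt_fst.prodMk contDiffAt_snd.fst)
  show ContDiffAt ℝ n (fun p : Param ↦ p.2.2.2 (eqPoint p.1 p.2.1)) p
  exact hT.clm_apply he

/-- The `0`-jet `J₀(p) = G_p(x_p)`. [folklore] -/
def jet0 (p : Param) : E4 →L[ℝ] E4 →L[ℝ] ℝ := fam p (pt p)

/-- The `1`-jet `J₁(p) = DG_p(x_p)`. [folklore] -/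
def jet1 (p : Param) : E4 →L[ℝ] E4 →L[ℝ] E4 →L[ℝ] ℝ := fderiv ℝ (fam p) (pt p)

/-- The `2`-jet `J₂(p) = D²G_p(x_p)`. [folklore] -/
def jet2 (p : Param) : E4 →L[ℝ] E4 →L[ℝ] E4 →L[ℝ] E4 →L[ℝ] ℝ := fderiv ℝ (fderiv ℝ (fam p)) (pt p)

/-- `(p, x) ↦ G_p(x)` is smooth at `(p, x_p)` for windowed `p`. [folklore] -/
theorem contDiffAt_fam_pt {n : WithTop ℕ∞} {m₀ ρ₀ : ℝ} (hm₀ : 0 < m₀) {p : Param}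
    (hp : p ∈ paramSet m₀ ρ₀) : ContDiffAt ℝ n (fun q : Param × E4 ↦ fam q.1 q.2) (p, pt p) :=
  contDiffAt_fam (q := (p, pt p)) (radius_pt_pos_of_mem hm₀ hp)

/-- `(p, x) ↦ DG_p(x)` is smooth at `(p, x_p)`. [folklore] -/
theorem contDiffAt_fderiv_fam_pt {n : WithTop ℕ∞} {m₀ ρ₀ : ℝ} (hm₀ : 0 < m₀) {p : Param}
    (hp : p ∈ paramSet m₀ ρ₀) :
    ContDiffAt ℝ n (fun q : Param × E4 ↦ fderiv ℝ (fam q.1) q.2) (p, pt p) := by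
  have h : ContDiffAt ℝ (n + 1) (uncurry fun (q : Param × E4) (x : E4) ↦ fam q.1 x) ((p, pt p), pt p) :=
    (contDiffAt_fam_pt (n := n + 1) hm₀ hp).comp ((p, pt p), pt p) (contDiffAt_fst.fst.prodMk contDiffAt_snd)
  exact h.fderiv contDiffAt_snd le_rfl

/-- `(p, x) ↦ D²G_p(x)` is smooth at `(p, x_p)`. [folklore] -/
theorem contDiffAt_fderiv_fderiv_fam_pt {n : WithTop ℕ∞} {m₀ ρ₀ : ℝ} (hm₀ : 0 < m₀) {p : Param}
    (hp : p ∈ paramSet m₀ ρ₀) :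
    ContDiffAt ℝ n (fun q : Param × E4 ↦ fderiv ℝ (fderiv ℝ (fam q.1)) q.2) (p, pt p) := by
  have h : ContDiffAt ℝ (n + 1) (uncurry fun (q : Param × E4) (x : E4) ↦ fderiv ℝ (fam q.1) x)
      ((p, pt p), pt p) :=
    (contDiffAt_fderiv_fam_pt (n := n + 1) hm₀ hp).comp ((p, pt p), pt p)
      (contDiffAt_fst.fst.prodMk contDiffAt_snd)
  exact h.fderiv contDiffAt_snd le_rfl

/-- The `0`-jet is continuous at windowed parameters. [folklore] -/
theorem continuousAt_jet0 {m₀ ρ₀ : ℝ} (hm₀ : 0 < m₀) {p : Param} (hp : p ∈ paramSet m₀ ρ₀) :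
    ContinuousAt jet0 p := by
  have h : ContDiffAt ℝ 0 (fun p : Param ↦ fam p (pt p)) p :=
    ContDiffAt.comp p (g := fun q : Param × E4 ↦ fam q.1 q.2) (f := fun x : Param ↦ (x, pt x))
      (contDiffAt_fam_pt hm₀ hp) (contDiffAt_id.prodMk (contDiff_pt hm₀ hp))
  exact h.continuousAt

/-- The `1`-jet is continuous at windowed parameters. [folklore] -/
theorem continuousAt_jet1 {m₀ ρ₀ : ℝ} (hm₀ : 0 < m₀) {p : Param} (hp : p ∈ paramSet m₀ ρ₀) :
    ContinuousAt jet1 p := by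
  have h : ContDiffAt ℝ 0 (fun p : Param ↦ fderiv ℝ (fam p) (pt p)) p :=
    ContDiffAt.comp p (g := fun q : Param × E4 ↦ fderiv ℝ (fam q.1) q.2) (f := fun x : Param ↦ (x, pt x))
      (contDiffAt_fderiv_fam_pt hm₀ hp) (contDiffAt_id.prodMk (contDiff_pt hm₀ hp))
  exact h.continuousAt

/-- The `2`-jet is continuous at windowed parameters. [folklore] -/
theorem continuousAt_jet2 {m₀ ρ₀ : ℝ} (hm₀ : 0 < m₀) {p : Param} (hp : p ∈ paramSet m₀ ρ₀) :
    ContinuousAt jet2 p := by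
  have h : ContDiffAt ℝ 0 (fun p : Param ↦ fderiv ℝ (fderiv ℝ (fam p)) (pt p)) p :=
    ContDiffAt.comp p (g := fun q : Param × E4 ↦ fderiv ℝ (fderiv ℝ (fam q.1)) q.2)
      (f := fun x : Param ↦ (x, pt x))
      (contDiffAt_fderiv_fderiv_fam_pt hm₀ hp) (contDiffAt_id.prodMk (contDiff_pt hm₀ hp))
  exact h.continuousAt

/-! ### Invertibility of the `0`-jet and continuity of its inverse -/

/-- Helper (`eqPoint_mem_region`); see the module docstring. [folklore] -/
theorem eqPoint_mem_region {m₀ ρ₀ : ℝ} (hm₀ : 0 < m₀) {p : Param} (hp : p ∈ paramSet m₀ ρ₀) :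
    eqPoint p.1 p.2.1 ∈ (Kerr.region p.2.1 p.1 : Set E4) := by
  have hM := mass_pos_of_mem hm₀ hp
  show max p.1 0 < Kerr.radius p.2.1 (eqPoint p.1 p.2.1)
  rw [radius_eqPoint hM.le, max_eq_left hM.le]
  linarith

/-- `S` and `T` of a windowed parameter are mutually inverse continuous linear equivalences. [folklore] -/
def linEquiv {m₀ ρ₀ : ℝ} {p : Param} (hp : p ∈ paramSet m₀ ρ₀) : E4 ≃L[ℝ] E4 :=
  ContinuousLinearEquiv.equivOfInverse p.2.2.1 p.2.2.2
    (fun x ↦ by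
      show (p.2.2.2.comp p.2.2.1) x = x
      rw [hp.2.2.2.2.2.2]; rfl)
    (fun x ↦ by
      show (p.2.2.1.comp p.2.2.2) x = x
      rw [hp.2.2.2.2.2.1]; rfl)

/-- Coercion of `linEquiv`. [folklore] -/
theorem coe_linEquiv {m₀ ρ₀ : ℝ} {p : Param} (hp : p ∈ paramSet m₀ ρ₀) :
    (linEquiv hp : E4 →L[ℝ] E4) = p.2.2.1 := rfl

/-- `precomp S` is invertible with inverse `precomp T`. [folklore] -/
def precompEquiv {m₀ ρ₀ : ℝ} {p : Param} (hp : p ∈ paramSet m₀ ρ₀) :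
    (E4 →L[ℝ] ℝ) ≃L[ℝ] (E4 →L[ℝ] ℝ) :=
  ContinuousLinearEquiv.equivOfInverse (ContinuousLinearMap.precomp ℝ p.2.2.1)
    (ContinuousLinearMap.precomp ℝ p.2.2.2)
    (fun f ↦ by
      ext v
      simp only [ContinuousLinearMap.precomp_apply, ContinuousLinearMap.coe_comp, Function.comp_apply]
      show f ((p.2.2.1.comp p.2.2.2) v) = f v
      rw [hp.2.2.2.2.2.1]; rfl)
    (fun f ↦ by
      ext v
      simp only [ContinuousLinearMap.precomp_apply, ContinuousLinearMap.coe_comp, Function.comp_apply]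
      show f ((p.2.2.2.comp p.2.2.1) v) = f v
      rw [hp.2.2.2.2.2.2]; rfl)

/-- Coercion of `precompEquiv`. [folklore] -/
theorem coe_precompEquiv {m₀ ρ₀ : ℝ} {p : Param} (hp : p ∈ paramSet m₀ ρ₀) :
    (precompEquiv hp : (E4 →L[ℝ] ℝ) →L[ℝ] (E4 →L[ℝ] ℝ)) = ContinuousLinearMap.precomp ℝ p.2.2.1 := rfl

/-- **The `0`-jet of a windowed parameter is invertible** (`Sᵀ g(y_e) S` with `g(y_e)` nondegenerate,
`isMetricOn_kerrBilin`, and `S` invertible). [cite: KerrSchild1965, §3] -/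
theorem isInvertible_jet0 {m₀ ρ₀ : ℝ} (hm₀ : 0 < m₀) {p : Param} (hp : p ∈ paramSet m₀ ρ₀) :
    (jet0 p).IsInvertible := by
  have hK : (Kerr.bilin p.1 p.2.1 (p.2.2.1 (pt p))).IsInvertible := by
    rw [apply_pt_of_mem hp]
    exact (KerrSchildChart.isMetricOn_kerrBilin p.1 p.2.1 p.1).isInvertible _ (eqPoint_mem_region hm₀ hp)
  have hS : (p.2.2.1).IsInvertible := ⟨linEquiv hp, coe_linEquiv hp⟩
  have hP : (ContinuousLinearMap.precomp ℝ p.2.2.1 : (E4 →L[ℝ] ℝ) →L[ℝ] (E4 →L[ℝ] ℝ)).IsInvertible :=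
    ⟨precompEquiv hp, coe_precompEquiv hp⟩
  exact hP.comp (hK.comp hS)

/-- The inverse of the `0`-jet is continuous at windowed parameters. [folklore] -/
theorem continuousAt_inverse_jet0 {m₀ ρ₀ : ℝ} (hm₀ : 0 < m₀) {p : Param} (hp : p ∈ paramSet m₀ ρ₀) :
    ContinuousAt (fun p ↦ (jet0 p).inverse) p :=
  ((isInvertible_jet0 hm₀ hp).contDiffAt_map_inverse (n := 0)).continuousAt.comp (continuousAt_jet0 hm₀ hp)

/-! ### The uniform bound over the window -/

/-- **Uniform `C²` bound over the window.** For `0 < m₀` there is `N ≥ 1` bounding, for every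
windowed parameter `p`, the inverse `‖(J₀ p)⁻¹‖`, the first jet `‖J₁ p‖` and the second jet `‖J₂ p‖`
(continuity on the compact parameter set). [folklore] -/
theorem exists_jet_bound {m₀ : ℝ} (hm₀ : 0 < m₀) (ρ₀ : ℝ) :
    ∃ N : ℝ, 1 ≤ N ∧ ∀ p ∈ paramSet m₀ ρ₀,
      ‖(jet0 p).inverse‖ ≤ N ∧ ‖jet1 p‖ ≤ N ∧ ‖jet2 p‖ ≤ N := by
  have hc := isCompact_paramSet m₀ ρ₀
  obtain ⟨C₀, hC₀⟩ := hc.exists_bound_of_continuousOn (f := fun p ↦ (jet0 p).inverse)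
    fun p hp ↦ (continuousAt_inverse_jet0 hm₀ hp).continuousWithinAt
  obtain ⟨C₁, hC₁⟩ := hc.exists_bound_of_continuousOn (f := jet1)
    fun p hp ↦ (continuousAt_jet1 hm₀ hp).continuousWithinAt
  obtain ⟨C₂, hC₂⟩ := hc.exists_bound_of_continuousOn (f := jet2)
    fun p hp ↦ (continuousAt_jet2 hm₀ hp).continuousWithinAt
  refine ⟨max 1 (max C₀ (max C₁ C₂)), le_max_left _ _, fun p hp ↦ ⟨?_, ?_, ?_⟩⟩
  · exact (hC₀ p hp).trans ((le_max_left _ _).trans (le_max_right _ _))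
  · exact (hC₁ p hp).trans ((le_max_left _ _).trans ((le_max_right _ _).trans (le_max_right _ _)))
  · exact (hC₂ p hp).trans ((le_max_right _ _).trans ((le_max_right _ _).trans (le_max_right _ _)))

end KerrWindow

/-! ## Part C: charts into Minkowski space — the flat chart metric and the jets of the deviation -/

namespace KerrWindow

section FlatChart

open MetricCoord

variable {B : ModelBackground}

/-- The ambient representative of a chart `Φ : B.domain → E4` (junk `0` off the domain). [folklore] -/
def rep (Φ : B.domain → E4) : E4 → E4 :=
  Function.extend Subtype.val Φ 0

/-- On the domain the representative is the chart. [folklore] -/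
theorem rep_coe (Φ : B.domain → E4) (y : B.domain) : Φ y = rep Φ y :=
  (Subtype.val_injective.extend_apply _ _ y).symm

/-- **The flat chart metric** `Φ^* η` in coordinates: `(Φ^*η)_y(v, w) = η(Dφ_y v, Dφ_y w)` with `φ`
the ambient representative — the pull-back of the CONSTANT components `η`. [folklore] -/
def chartForm (Φ : B.domain → E4) : E4 → E4 →L[ℝ] E4 →L[ℝ] ℝ :=
  pullMetric (fun _ : E4 ↦ Minkowski.bilin) (rep Φ)

/-- Unfolding lemma for `chartForm`. [folklore] -/
theorem chartForm_apply (Φ : B.domain → E4) (y v w : E4) :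
    chartForm Φ y v w = Minkowski.bilin (fderiv ℝ (rep Φ) y v) (fderiv ℝ (rep Φ) y w) := rfl

/-- The constant components `η` are metric components on all of `E4`. [cite: ONeill1983, Ch. 3  p. 55] -/
theorem isMetricOn_minkowski_const : IsMetricOn (fun _ : E4 ↦ Minkowski.bilin) (univ : Set E4) where
  isOpen := isOpen_univ
  contDiffOn := contDiffOn_const
  symm _ _ v w := Minkowski.bilin_symm v w
  isInvertible _ _ := isInvertible_of_nondegenerate Minkowski.bilin_nondegenerate

variable {Φ : B.domain → E4}

/-- Smoothness of the chart in the manifold sense (target Minkowski space, the canonical charted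
structure of `E4`) is smoothness of its ambient representative. [folklore] -/
theorem contDiffAt_rep {x : B.domain} (h : ContMDiffAt 𝓘(ℝ, E4) 𝓘(ℝ, E4) ∞ Φ x) :
    ContDiffAt ℝ ∞ (rep Φ) x :=
  (OpensChart.contMDiffAt_iff x Φ (rep Φ) (rep_coe Φ)).1 h

/-- The deviation of the chart from the background at a smooth point is `Φ^*η − g_B` with the flat
chart metric in coordinates. [folklore] -/
theorem deviation_eq {x : B.domain} (h : ContMDiffAt 𝓘(ℝ, E4) 𝓘(ℝ, E4) ∞ Φ x) :
    Minkowski.spacetime.deviation B Φ x = chartForm Φ x - B.bilin x.1 := by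
  have hd : DifferentiableAt ℝ (rep Φ) x := (contDiffAt_rep h).differentiableAt (by simp)
  ext v w
  change Minkowski.bilin (mfderiv 𝓘(ℝ, E4) (𝓡 4) Φ x v) (mfderiv 𝓘(ℝ, E4) (𝓡 4) Φ x w) - B.bilin x.1 v w = _
  rw [OpensChart.mfderiv_eq x Φ (rep Φ) (rep_coe Φ) hd]
  rfl

/-- The image of an open set of the (open) domain is open in `E4`. [folklore] -/
theorem isOpen_image_val {L : Set B.domain} (hL : IsOpen L) : IsOpen (Subtype.val '' L : Set E4) :=
  B.domain.isOpen.isOpenMap_subtype_val L hL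

/-- **On the image of an open set of smooth points the extended deviation IS `Φ^*η − g_B`.** [folklore] -/
theorem deviationExtend_eq_of_mem {L : Set B.domain} (hΦ : ContMDiffOn 𝓘(ℝ, E4) 𝓘(ℝ, E4) ∞ Φ L)
    (hL : IsOpen L) {y : E4} (hy : y ∈ (Subtype.val '' L : Set E4)) :
    Minkowski.spacetime.deviationExtend B Φ y = chartForm Φ y - B.bilin y := by
  obtain ⟨x, hx, rfl⟩ := hy
  rw [Spacetime.deviationExtend_coe, deviation_eq ((hΦ x hx).contMDiffAt (hL.mem_nhds hx))]

/-- The ambient representative is smooth on the image of an open set of smooth points. [folklore] -/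
theorem contDiffAt_rep_of_mem {L : Set B.domain} (hΦ : ContMDiffOn 𝓘(ℝ, E4) 𝓘(ℝ, E4) ∞ Φ L)
    (hL : IsOpen L) {y : E4} (hy : y ∈ (Subtype.val '' L : Set E4)) : ContDiffAt ℝ ∞ (rep Φ) y := by
  obtain ⟨x, hx, rfl⟩ := hy
  exact contDiffAt_rep ((hΦ x hx).contMDiffAt (hL.mem_nhds hx))

/-- The flat chart metric is smooth where the representative is. [folklore] -/
theorem contDiffAt_chartForm {y : E4} (h : ContDiffAt ℝ ∞ (rep Φ) y) : ContDiffAt ℝ ∞ (chartForm Φ) y := by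
  have hD : ContDiffAt ℝ ∞ (fderiv ℝ (rep Φ)) y := h.fderiv_right (m := ∞) (by norm_cast)
  have heq : chartForm Φ = fun y ↦ flipCLM ((flipCLM ((Minkowski.bilin).comp (fderiv ℝ (rep Φ) y))).comp
      (fderiv ℝ (rep Φ) y)) := funext fun y ↦ pullMetric_eq_flip _ _ y
  rw [heq]
  have h1 : ContDiffAt ℝ ∞ (fun y ↦ (Minkowski.bilin).comp (fderiv ℝ (rep Φ) y)) y :=
    contDiffAt_const.clm_comp hD
  have hflip : ContDiff ℝ ∞ (flipCLM : (E4 →L[ℝ] E4 →L[ℝ] ℝ) →L[ℝ] (E4 →L[ℝ] E4 →L[ℝ] ℝ)) :=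
    (flipCLM (E := E4)).contDiff
  have h2 : ContDiffAt ℝ ∞ (fun y ↦ flipCLM ((Minkowski.bilin).comp (fderiv ℝ (rep Φ) y))) y :=
    ContDiffAt.comp y (g := flipCLM) hflip.contDiffAt h1
  exact ContDiffAt.comp y (g := flipCLM) hflip.contDiffAt (h2.clm_comp hD)

/-- The flat chart metric is symmetric. [folklore] -/
theorem chartForm_symm (Φ : B.domain → E4) (y v w : E4) : chartForm Φ y v w = chartForm Φ y w v := by
  rw [chartForm_apply, chartForm_apply, Minkowski.bilin_symm]

/-- **Nondegeneracy of `Φ^*η` forces `Dφ` invertible.** [folklore] -/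
theorem isInvertible_fderiv_rep {y : E4} (h : (chartForm Φ y).IsInvertible) :
    (fderiv ℝ (rep Φ) y).IsInvertible := by
  refine KerrSchildChart.isInvertible_of_injective fun v w hvw ↦ ?_
  obtain ⟨e, he⟩ := h
  have h0 : chartForm Φ y (v - w) = 0 := by
    ext u
    rw [chartForm_apply, map_sub, hvw, sub_self]
    simp
  have : e (v - w) = 0 := by rw [← ContinuousLinearEquiv.coe_coe, he, h0]
  exact sub_eq_zero.1 (e.map_eq_zero_iff.1 this)

/-- **The flat chart metric is flat**: at a point with a neighbourhood of smooth points on which it is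
nondegenerate, all its curvature endomorphisms vanish (`riemAt_pullMetric_const`: it is the pull-back
of the constant `η` along a change of coordinates). O'Neill 1983, Ch. 3, Prop. 3.59 with Prop. 3.41.
[cite: ONeill1983, Ch. 3, Prop. 3.59] -/
theorem riemAt_chartForm_eq_zero {W : Set E4} (hW : IsOpen W) (hsm : ∀ y ∈ W, ContDiffAt ℝ ∞ (rep Φ) y)
    (hinv : ∀ y ∈ W, (chartForm Φ y).IsInvertible) {y : E4} (hy : y ∈ W) (X Y : E4) :
    riemAt (chartForm Φ) y X Y = 0 := by
  have hcc : IsCoordChangeOn (rep Φ) W univ :=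
    { isOpen := hW
      contDiffOn := fun y hy ↦ (hsm y hy).contDiffWithinAt
      mapsTo := fun _ _ ↦ trivial
      isInvertible := fun y hy ↦ isInvertible_fderiv_rep (hinv y hy) }
  exact riemAt_pullMetric_const isMetricOn_minkowski_const hcc hy X Y

/-- The flat chart metric gives metric components on an open set of smooth nondegenerate points. [folklore] -/
theorem isMetricOn_chartForm {W : Set E4} (hW : IsOpen W) (hsm : ∀ y ∈ W, ContDiffAt ℝ ∞ (rep Φ) y)
    (hinv : ∀ y ∈ W, (chartForm Φ y).IsInvertible) : IsMetricOn (chartForm Φ) W where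
  isOpen := hW
  contDiffOn y hy := (contDiffAt_chartForm (hsm y hy)).contDiffWithinAt
  symm y _ v w := chartForm_symm Φ y v w
  isInvertible := hinv

/-- **The jets of the deviation at a smooth point are the differences of the jets** of `Φ^*η` and of
the (smooth) background components. [folklore] -/
theorem jets_deviationExtend {L : Set B.domain} (hΦ : ContMDiffOn 𝓘(ℝ, E4) 𝓘(ℝ, E4) ∞ Φ L)
    (hL : IsOpen L) (hB : ∀ y ∈ (Subtype.val '' L : Set E4), ContDiffAt ℝ ∞ B.bilin y)
    {y : E4} (hy : y ∈ (Subtype.val '' L : Set E4)) :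
    Minkowski.spacetime.deviationExtend B Φ y = chartForm Φ y - B.bilin y ∧
    fderiv ℝ (Minkowski.spacetime.deviationExtend B Φ) y = fderiv ℝ (chartForm Φ) y - fderiv ℝ B.bilin y ∧
    fderiv ℝ (fderiv ℝ (Minkowski.spacetime.deviationExtend B Φ)) y =
      fderiv ℝ (fderiv ℝ (chartForm Φ)) y - fderiv ℝ (fderiv ℝ B.bilin) y := by
  have hO := isOpen_image_val hL
  have hev : Minkowski.spacetime.deviationExtend B Φ =ᶠ[𝓝 y] fun z ↦ chartForm Φ z - B.bilin z := by
    filter_upwards [hO.mem_nhds hy] with z hz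
    exact deviationExtend_eq_of_mem hΦ hL hz
  have hsm : ∀ z ∈ (Subtype.val '' L : Set E4), ContDiffAt ℝ ∞ (chartForm Φ) z := fun z hz ↦
    contDiffAt_chartForm (contDiffAt_rep_of_mem hΦ hL hz)
  refine ⟨deviationExtend_eq_of_mem hΦ hL hy, ?_, ?_⟩
  · rw [hev.fderiv_eq]
    exact fderiv_sub ((hsm y hy).differentiableAt (by simp)) ((hB y hy).differentiableAt (by simp))
  · have h2 : fderiv ℝ (Minkowski.spacetime.deviationExtend B Φ) =ᶠ[𝓝 y]
        fderiv ℝ (fun z ↦ chartForm Φ z - B.bilin z) := hev.fderiv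
    rw [h2.fderiv_eq]
    exact KerrSchildChart.fderiv_fderiv_sub_of_isOpen hO hsm hB hy

end FlatChart

/-! ## Part D: assembly — no `C²`-quiet windowed, bounded-boost thick Kerr collar chart in Minkowski space -/

section Assembly

open MetricCoord

/-- The inverse Poincaré map is a change of coordinates from the boosted STAR domain
`Λ({r > M}) + c` onto the Kerr–Schild star chart domain `{r > M}`. [folklore] -/
theorem isCoordChangeOn_poincareInv_region (Λ : lorentzGroup) (c : E4) (a r₀ : ℝ) :
    IsCoordChangeOn (poincareInv Λ c) (poincareInv Λ c ⁻¹' (Kerr.region a r₀ : Set E4))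
      (Kerr.region a r₀ : Set E4) where
  isOpen := (Kerr.region a r₀).isOpen.preimage (continuous_poincareInv Λ c)
  contDiffOn := (KerrSchildChart.contDiff_poincareInv Λ c).contDiffOn
  mapsTo _ hy := hy
  isInvertible y _ := ⟨(Λ : E4 ≃L[ℝ] E4).symm, (KerrSchildChart.fderiv_poincareInv Λ c y).symm⟩

/-- The boosted Kerr–Schild form is the translate of the conjugated family member:
`g_B(y) = G_p(y − c)`, `p = (M, a, Λ⁻¹, Λ)`. [cite: KerrSchild1965] -/
theorem boostedKerrBilin_eq_fam (Λ : lorentzGroup) (c : E4) (M a : ℝ) (y : E4) :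
    boostedKerrBilin Λ c M a y =
      fam (M, a, ((Λ : E4 ≃L[ℝ] E4).symm : E4 →L[ℝ] E4), ((Λ : E4 ≃L[ℝ] E4) : E4 →L[ℝ] E4)) (y - c) := by
  ext v w
  rw [boostedKerrBilin_apply, fam_apply]
  rfl

/-- Jets of a translate: `D[g(· − c)](y) = Dg(y − c)` and `D²[g(· − c)](y) = D²g(y − c)`. [folklore] -/
theorem fderiv_comp_sub_const' {F : Type*} [NormedAddCommGroup F] [NormedSpace ℝ F] (g : E4 → F) (c : E4) :
    fderiv ℝ (fun y ↦ g (y - c)) = fun y ↦ fderiv ℝ g (y - c) := by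
  funext y
  simp_rw [sub_eq_add_neg]
  exact fderiv_comp_add_right (-c)

/-- **Naturality of `|Rm|²` under a change of coordinates.** [cite: ONeill1983, Ch. 3, Prop. 3.59] -/
theorem rmNormSqAt_pullMetric {G : E4 → E4 →L[ℝ] E4 →L[ℝ] ℝ} {V V' : Set E4} {ψ : E4 → E4} {y : E4}
    (hG : IsMetricOn G V) (hψ : IsCoordChangeOn ψ V' V) (hy : y ∈ V') :
    rmNormSqAt (pullMetric G ψ) y = rmNormSqAt G (ψ y) := by
  obtain ⟨D, hD⟩ := hψ.isInvertible y hy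
  set b := (EuclideanSpace.basisFun (Fin 4) ℝ).toBasis
  rw [rmNormSqAt_eq_sum b, rmNormSqAt_eq_sum (b.map D.toLinearEquiv), quadTrace_pullMetric b hG hψ hy hD]

/-- The parameter of a windowed motion lies in the windowed parameter set. [folklore] -/
theorem mem_paramSet_of {m₀ ρ₀ M a : ℝ} (Λ : lorentzGroup) (hlo : m₀ ≤ M) (hhi : M ≤ m₀⁻¹) (ha : |a| ≤ M)
    (hΛ : ‖((Λ : E4 ≃L[ℝ] E4) : E4 →L[ℝ] E4)‖ ≤ ρ₀) (hΛ' : ‖((Λ : E4 ≃L[ℝ] E4).symm : E4 →L[ℝ] E4)‖ ≤ ρ₀) :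
    ((M, a, ((Λ : E4 ≃L[ℝ] E4).symm : E4 →L[ℝ] E4), ((Λ : E4 ≃L[ℝ] E4) : E4 →L[ℝ] E4)) : Param) ∈
      paramSet m₀ ρ₀ :=
  ⟨hlo, hhi, ha, hΛ', hΛ, ContinuousLinearEquiv.coe_symm_comp_coe _, ContinuousLinearEquiv.coe_comp_coe_symm _⟩

end Assembly

section Main

open MetricCoord

/-- The collar layer `{−1 < t < 1, r < R}` of (a background with the fields of) a star background is
open. [folklore] -/
theorem isOpen_layer {B : ModelBackground} (Λ : lorentzGroup) (c : E4) (a R : ℝ)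
    (htime : B.time = fun x ↦ poincareInv Λ c x 0) (hradius : B.radius = fun x ↦ Kerr.radius a (poincareInv Λ c x)) :
    IsOpen {x : B.domain | -1 < B.time x.1 ∧ B.time x.1 < 1 ∧ B.radius x.1 < R} := by
  have ht : Continuous fun x : B.domain ↦ B.time x.1 := by
    rw [htime]
    exact (continuous_apply 0).comp ((PiLp.continuous_ofLp 2 _).comp
      ((continuous_poincareInv Λ c).comp continuous_subtype_val))
  have hr : Continuous fun x : B.domain ↦ B.radius x.1 := by
    rw [hradius]
    exact (Kerr.continuous_radius a).comp ((continuous_poincareInv Λ c).comp continuous_subtype_val)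
  exact (isOpen_lt continuous_const ht).inter ((isOpen_lt ht continuous_const).inter (isOpen_lt hr continuous_const))

set_option maxHeartbeats 1600000 in
/-- **WINDOWED KRETSCHMANN JUNK EXCLUSION IN MINKOWSKI SPACE.** Given the closed form of the Kretschmann
scalar of Kerr (the named fact `Kerr.kretschmannScalar_closedForm`, hypothesis `hQ`), for every label
window `m₀ > 0` and boost bound `ρ₀` there is `δ₀ > 0` such that EVERY thick Kerr collar chart `Φ₁` of
Minkowski space modelled on the boosted Kerr star background `B₁ = (Λ, c, M₁, a₁)` with windowed label
`m₀ ≤ M₁ ≤ m₀⁻¹`, `|a₁| ≤ M₁`, bounded boost `‖Λ‖, ‖Λ⁻¹‖ ≤ ρ₀`, smooth on the collar layer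
`{−1 < t* < 1, r < 3M₁ + 1}`, has `C²`-deviation `> δ₀` on the thick slab `{t* = 0, M₁ < r ≤ 3M₁}`:
at the image of the equatorial slab point `Λ(0, √(4M₁² + a₁²), 0, 0) + c` (`r = 2M₁`) the chart
metric `Φ₁^*η` is FLAT while the background has `|Rm|² = 48M₁²/(2M₁)⁶ = ¾M₁⁻⁴ ≥ ¾m₀⁴`, and the
`C²`-perturbation estimate (`abs_rmNormSqAt_le_of_flat_close`, uniform constants over the compact
window by `exists_jet_bound`, `exists_uniform_inverse_bound`) makes these incompatible for small `δ₀`.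
Consequence: Minkowski space satisfies the windowed, boost-bounded collar-margin clause (C‴ of crux
`GenericCensorshipCollarMargin`, stmt-FinalStateConjecture-10809) VACUOUSLY at order `k₁ = 2` — the
restated clause is junk-free in flat space, unlike the filed one (Nash–Kuiper junk at `M₁ → ∞`).
No open-embedding hypothesis is needed. [cite: arXiv07060622, §3] -/
theorem minkowski_truncDeviationCk_gt_of_window
    (hQ : Kerr.kretschmannScalar_closedForm)
    {m₀ : ℝ} (hm₀ : 0 < m₀) (ρ₀ : ℝ) :
    ∃ δ₀ : ℝ, 0 < δ₀ ∧ ∀ (M₁ a₁ : ℝ) (Λ : lorentzGroup) (c : E4) (B : ModelBackground)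
      (Φ₁ : B.domain → E4),
      m₀ ≤ M₁ → M₁ ≤ m₀⁻¹ → |a₁| ≤ M₁ →
      ‖((Λ : E4 ≃L[ℝ] E4) : E4 →L[ℝ] E4)‖ ≤ ρ₀ → ‖((Λ : E4 ≃L[ℝ] E4).symm : E4 →L[ℝ] E4)‖ ≤ ρ₀ →
      B = starBackground Λ c M₁ a₁ (fun x ↦ Kerr.radius a₁ (poincareInv Λ c x)) →
      ContMDiffOn 𝓘(ℝ, E4) 𝓘(ℝ, E4) ∞ Φ₁
        {x | -1 < B.time x.1 ∧ B.time x.1 < 1 ∧ B.radius x.1 < 3 * M₁ + 1} →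
      ENNReal.ofReal δ₀ < Minkowski.spacetime.truncDeviationCk B Φ₁ 2 (3 * M₁) 0 := by
  -- uniform constants over the window
  obtain ⟨N, hN1, hN⟩ := exists_jet_bound hm₀ ρ₀
  have hKc : IsCompact (jet0 '' paramSet m₀ ρ₀) :=
    (isCompact_paramSet m₀ ρ₀).image_of_continuousOn fun p hp ↦ (continuousAt_jet0 hm₀ hp).continuousWithinAt
  obtain ⟨δ₁, hδ₁, C, hC⟩ := exists_uniform_inverse_bound hKc
    (by rintro _ ⟨p, hp, rfl⟩; exact isInvertible_jet0 hm₀ hp)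
  set N' : ℝ := max (N + 1) (max C 1) with hN'
  have hN'1 : 1 ≤ N' := le_trans (le_max_right C 1) (le_max_right _ _)
  have hNN' : N ≤ N' := by linarith [le_max_left (N + 1) (max C 1)]
  have hCN' : C ≤ N' := (le_max_left C 1).trans (le_max_right _ _)
  set A : ℝ := (4 : ℝ) ^ 4 * N' ^ 2 * (4 * (42 * N' ^ 5) ^ 2) with hA
  have hA0 : 0 ≤ A := by positivity
  set δ₀ : ℝ := min δ₁ (min 1 (3 / 4 * m₀ ^ 4 / (A + 1))) with hδ₀
  have hδ₀pos : 0 < δ₀ := lt_min hδ₁ (lt_min one_pos (by positivity))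
  have hδ₀1 : δ₀ ≤ 1 := (min_le_right _ _).trans (min_le_left _ _)
  have hδ₀δ₁ : δ₀ ≤ δ₁ := min_le_left _ _
  have hδ₀A : δ₀ ≤ 3 / 4 * m₀ ^ 4 / (A + 1) := (min_le_right _ _).trans (min_le_right _ _)
  refine ⟨δ₀, hδ₀pos, fun M₁ a₁ Λ c B Φ₁ hlo hhi ha hΛ hΛ' hB hΦ ↦ ?_⟩
  by_contra hnot
  have hle : supCkENorm (Subtype.val '' B.truncTimeSlab (3 * M₁) 0) 2
      (Minkowski.spacetime.deviationExtend B Φ₁) ≤ ENNReal.ofReal δ₀ := not_lt.1 hnot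
  -- the fields of the background
  have hbil : B.bilin = boostedKerrBilin Λ c M₁ a₁ := by rw [hB]; rfl
  have htimeF : B.time = fun x ↦ poincareInv Λ c x 0 := by rw [hB]; rfl
  have hradF : B.radius = fun x ↦ Kerr.radius a₁ (poincareInv Λ c x) := by rw [hB]; rfl
  have hdomF : (B.domain : Set E4) = poincareInv Λ c ⁻¹' (Kerr.region a₁ M₁ : Set E4) := by rw [hB]; rfl
  -- the parameter and the comparison point
  set p : Param := (M₁, a₁, ((Λ : E4 ≃L[ℝ] E4).symm : E4 →L[ℝ] E4), ((Λ : E4 ≃L[ℝ] E4) : E4 →L[ℝ] E4))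
    with hpdef
  have hp : p ∈ paramSet m₀ ρ₀ := mem_paramSet_of Λ hlo hhi ha hΛ hΛ'
  have hM : 0 < M₁ := hm₀.trans_le hlo
  set ye : E4 := eqPoint M₁ a₁ with hye
  set xe : E4 := (Λ : E4 ≃L[ℝ] E4) ye + c with hxe
  have hpt : pt p = (Λ : E4 ≃L[ℝ] E4) ye := rfl
  have hxc : xe - c = pt p := by rw [hpt, hxe, add_sub_cancel_right]
  have hP : poincareInv Λ c xe = ye := by
    show (Λ : E4 ≃L[ℝ] E4).symm (xe - c) = ye
    rw [hxe, add_sub_cancel_right, ContinuousLinearEquiv.symm_apply_apply]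
  have hye_reg : ye ∈ (Kerr.region a₁ M₁ : Set E4) := eqPoint_mem_region hm₀ hp
  have hxe_dom : xe ∈ (B.domain : Set E4) := by
    rw [hdomF]; show poincareInv Λ c xe ∈ (Kerr.region a₁ M₁ : Set E4); rw [hP]; exact hye_reg
  set x : B.domain := ⟨xe, hxe_dom⟩ with hxdef
  have htime : B.time xe = 0 := by
    rw [htimeF]; show (poincareInv Λ c xe) 0 = 0; rw [hP]; exact eqPoint_zero M₁ a₁
  have hrad : B.radius xe = 2 * M₁ := by
    rw [hradF]; show Kerr.radius a₁ (poincareInv Λ c xe) = 2 * M₁; rw [hP]; exact radius_eqPoint hM.le a₁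
  set L : Set B.domain := {x | -1 < B.time x.1 ∧ B.time x.1 < 1 ∧ B.radius x.1 < 3 * M₁ + 1} with hLdef
  have hL : IsOpen L := isOpen_layer Λ c a₁ (3 * M₁ + 1) htimeF hradF
  have hxL : x ∈ L := by
    refine ⟨?_, ?_, ?_⟩
    · show -1 < B.time xe; rw [htime]; norm_num
    · show B.time xe < 1; rw [htime]; norm_num
    · show B.radius xe < 3 * M₁ + 1; rw [hrad]; linarith
  have hslab : x ∈ B.truncTimeSlab (3 * M₁) 0 := ⟨htime, by show B.radius xe ≤ 3 * M₁; rw [hrad]; linarith⟩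
  have hxeW₀ : xe ∈ (Subtype.val '' L : Set E4) := mem_image_of_mem Subtype.val hxL
  -- the jets of the deviation at `xe` are `≤ δ₀`
  have hjet : ∀ m ≤ 2, ‖iteratedFDeriv ℝ m (Minkowski.spacetime.deviationExtend B Φ₁) xe‖ ≤ δ₀ := by
    intro m hm
    have h := enorm_iteratedFDeriv_le_supCkENorm hm (mem_image_of_mem Subtype.val hslab)
      (Minkowski.spacetime.deviationExtend B Φ₁)
    have h2 : ‖iteratedFDeriv ℝ m (Minkowski.spacetime.deviationExtend B Φ₁) xe‖ₑ ≤ ENNReal.ofReal δ₀ :=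
      h.trans hle
    rwa [← ofReal_norm, ENNReal.ofReal_le_ofReal_iff hδ₀pos.le] at h2
  have hd0 : ‖Minkowski.spacetime.deviationExtend B Φ₁ xe‖ ≤ δ₀ := by
    have h := hjet 0 (by norm_num); rwa [norm_iteratedFDeriv_zero] at h
  have hd1 : ‖fderiv ℝ (Minkowski.spacetime.deviationExtend B Φ₁) xe‖ ≤ δ₀ := by
    have h := hjet 1 (by norm_num)
    rwa [← norm_iteratedFDeriv_fderiv (n := 0), norm_iteratedFDeriv_zero] at h
  have hd2 : ‖fderiv ℝ (fderiv ℝ (Minkowski.spacetime.deviationExtend B Φ₁)) xe‖ ≤ δ₀ := by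
    have h := hjet 2 le_rfl
    rwa [← norm_iteratedFDeriv_fderiv (n := 1), ← norm_iteratedFDeriv_fderiv (n := 0),
      norm_iteratedFDeriv_zero] at h
  -- the background components and their jets at `xe`
  have hGfam : B.bilin = fun y ↦ fam p (y - c) := by
    rw [hbil]; exact funext (boostedKerrBilin_eq_fam Λ c M₁ a₁)
  have hG0 : B.bilin xe = jet0 p := by
    rw [hGfam]; show fam p (xe - c) = fam p (pt p); rw [hxc]
  have hG1 : fderiv ℝ B.bilin xe = jet1 p := by
    rw [hGfam, fderiv_comp_sub_const']; show fderiv ℝ (fam p) (xe - c) = fderiv ℝ (fam p) (pt p); rw [hxc]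
  have hG2 : fderiv ℝ (fderiv ℝ B.bilin) xe = jet2 p := by
    rw [hGfam, fderiv_comp_sub_const', fderiv_comp_sub_const' (fderiv ℝ (fam p)) c]
    show fderiv ℝ (fderiv ℝ (fam p)) (xe - c) = fderiv ℝ (fderiv ℝ (fam p)) (pt p); rw [hxc]
  obtain ⟨hNinv, hNj1, hNj2⟩ := hN p hp
  have hGm : IsMetricOn B.bilin (B.domain : Set E4) := by
    have h := (KerrSchildChart.isMetricOn_kerrBilin M₁ a₁ M₁).isMetricOn_pullMetric
      (isCoordChangeOn_poincareInv_region Λ c a₁ M₁)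
    rw [← KerrSchildChart.boostedKerrBilin_eq_pullMetric Λ c M₁ a₁] at h
    rw [hbil, hdomF]
    exact h
  have hBsm : ∀ y ∈ (Subtype.val '' L : Set E4), ContDiffAt ℝ ∞ B.bilin y := by
    rintro _ ⟨z, _, rfl⟩
    exact (hGm.contDiffOn z.1 z.2).contDiffAt (B.domain.isOpen.mem_nhds z.2)
  -- the flat chart metric and the jets of the deviation as differences
  obtain ⟨e0, e1, e2⟩ := jets_deviationExtend hΦ hL hBsm hxeW₀
  have hc0 : ‖B.bilin xe - chartForm Φ₁ xe‖ ≤ δ₀ := by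
    rw [norm_sub_rev, ← e0]; exact hd0
  have hc1 : ‖fderiv ℝ B.bilin xe - fderiv ℝ (chartForm Φ₁) xe‖ ≤ δ₀ := by
    rw [norm_sub_rev, ← e1]; exact hd1
  have hc2 : ‖fderiv ℝ (fderiv ℝ B.bilin) xe - fderiv ℝ (fderiv ℝ (chartForm Φ₁)) xe‖ ≤ δ₀ := by
    rw [norm_sub_rev, ← e2]; exact hd2
  -- the chart metric is nondegenerate at `xe`, with inverse bounded by `C`
  have hG'inv : (chartForm Φ₁ xe).IsInvertible ∧ ‖(chartForm Φ₁ xe).inverse‖ ≤ C := by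
    refine hC (jet0 p) (mem_image_of_mem jet0 hp) (chartForm Φ₁ xe) ?_
    rw [← hG0, ← norm_sub_rev]; exact hc0.trans hδ₀δ₁
  -- the open set of smooth nondegenerate chart points around `xe`
  set W : Set E4 := (Subtype.val '' L : Set E4) ∩ chartForm Φ₁ ⁻¹' {T | T.IsInvertible} with hWdef
  have hsmL : ∀ y ∈ (Subtype.val '' L : Set E4), ContDiffAt ℝ ∞ (rep Φ₁) y := fun y hy ↦
    contDiffAt_rep_of_mem hΦ hL hy
  have hW : IsOpen W := by
    refine ContinuousOn.isOpen_inter_preimage (fun y hy ↦ ?_) (isOpen_image_val hL) isOpen_setOf_isInvertible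
    exact (contDiffAt_chartForm (hsmL y hy)).continuousAt.continuousWithinAt
  have hxeW : xe ∈ W := ⟨hxeW₀, hG'inv.1⟩
  have hWL : W ⊆ (Subtype.val '' L : Set E4) := inter_subset_left
  have hWdom : W ⊆ (B.domain : Set E4) := fun y hy ↦ by
    obtain ⟨z, _, rfl⟩ := hWL hy; exact z.2
  have hG'm : IsMetricOn (chartForm Φ₁) W :=
    isMetricOn_chartForm hW (fun y hy ↦ hsmL y (hWL hy)) (fun y hy ↦ hy.2)
  have hGmW : IsMetricOn B.bilin W := KerrSchildChart.isMetricOn_mono hGm hW hWdom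
  have hflat : ∀ X Y Z : E4, riemAt (chartForm Φ₁) xe X Y Z = 0 := fun X Y Z ↦ by
    rw [riemAt_chartForm_eq_zero hW (fun y hy ↦ hsmL y (hWL hy)) (fun y hy ↦ hy.2) hxeW X Y]; rfl
  -- the bounds fed to the flat comparison
  have hs : ‖sharpAt B.bilin xe‖ ≤ N' := by
    show ‖(B.bilin xe).inverse‖ ≤ N'; rw [hG0]; exact hNinv.trans hNN'
  have hs' : ‖sharpAt (chartForm Φ₁) xe‖ ≤ N' := hG'inv.2.trans hCN'
  have h1 : ‖fderiv ℝ B.bilin xe‖ ≤ N' := by rw [hG1]; exact hNj1.trans hNN'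
  have h1' : ‖fderiv ℝ (chartForm Φ₁) xe‖ ≤ N' := by
    have : ‖fderiv ℝ (chartForm Φ₁) xe‖ ≤ ‖fderiv ℝ B.bilin xe‖ + δ₀ := by
      calc ‖fderiv ℝ (chartForm Φ₁) xe‖
          = ‖fderiv ℝ B.bilin xe - (fderiv ℝ B.bilin xe - fderiv ℝ (chartForm Φ₁) xe)‖ := by rw [sub_sub_cancel]
        _ ≤ ‖fderiv ℝ B.bilin xe‖ + ‖fderiv ℝ B.bilin xe - fderiv ℝ (chartForm Φ₁) xe‖ := norm_sub_le _ _
        _ ≤ ‖fderiv ℝ B.bilin xe‖ + δ₀ := by gcongr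
    rw [hG1] at this
    linarith [le_max_left (N + 1) (max C 1)]
  have h2 : ‖fderiv ℝ (fderiv ℝ B.bilin) xe‖ ≤ N' := by rw [hG2]; exact hNj2.trans hNN'
  have key := hGmW.abs_rmNormSqAt_le_of_flat_close (EuclideanSpace.basisFun (Fin 4) ℝ) hG'm hxeW hN'1
    hδ₀pos.le hs hs' h1 h1' h2 hflat hc0 hc1 hc2
  -- the Kerr value at the equatorial point
  have hval : rmNormSqAt B.bilin xe = 48 * M₁ ^ 2 / (2 * M₁) ^ 6 := by
    have hG : B.bilin = pullMetric (Kerr.bilin M₁ a₁) (poincareInv Λ c) := by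
      rw [hbil]; exact KerrSchildChart.boostedKerrBilin_eq_pullMetric Λ c M₁ a₁
    have hxe_dom' : xe ∈ poincareInv Λ c ⁻¹' (Kerr.region a₁ M₁ : Set E4) := by rw [← hdomF]; exact hxe_dom
    rw [hG, rmNormSqAt_pullMetric (KerrSchildChart.isMetricOn_kerrBilin M₁ a₁ M₁)
      (isCoordChangeOn_poincareInv_region Λ c a₁ M₁) hxe_dom', hP]
    have hr : 0 < Kerr.radius a₁ ye := by rw [hye, radius_eqPoint hM.le]; positivity
    rw [Kerr.kretschmannScalar_equatorial hQ M₁ a₁ hr (eqPoint_three M₁ a₁), hye, radius_eqPoint hM.le]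
  -- numerics
  have hcard : (Fintype.card (Fin 4) : ℝ) = 4 := by norm_num
  have hrank : (Module.finrank ℝ E4 : ℝ) = 4 := by
    rw [finrank_euclideanSpace_fin]; norm_num
  rw [hcard, hrank, hval] at key
  have hM4 : 48 * M₁ ^ 2 / (2 * M₁) ^ 6 = 3 / 4 * (M₁ ^ 4)⁻¹ := by
    field_simp; ring
  have hlow : 3 / 4 * m₀ ^ 4 ≤ 48 * M₁ ^ 2 / (2 * M₁) ^ 6 := by
    rw [hM4]
    have hm4 : M₁ ^ 4 ≤ (m₀ ^ 4)⁻¹ := by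
      rw [← inv_pow]; exact pow_le_pow_left₀ hM.le hhi 4
    have : m₀ ^ 4 ≤ (M₁ ^ 4)⁻¹ := by
      rw [le_inv_comm₀ (by positivity) (by positivity)]; exact hm4
    linarith
  have hup : (4 : ℝ) ^ 4 * N' ^ 2 * (4 * (42 * N' ^ 5 * δ₀) ^ 2) = A * δ₀ ^ 2 := by rw [hA]; ring
  have habs : 48 * M₁ ^ 2 / (2 * M₁) ^ 6 ≤ A * δ₀ ^ 2 := by
    rw [← hup]; exact (le_abs_self _).trans key
  have hδA : A * δ₀ ^ 2 < 3 / 4 * m₀ ^ 4 := by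
    have h1 : A * δ₀ ^ 2 ≤ A * δ₀ := by
      rw [sq]; exact mul_le_mul_of_nonneg_left (mul_le_of_le_one_left hδ₀pos.le hδ₀1) hA0
    have h2 : A * δ₀ ≤ A * (3 / 4 * m₀ ^ 4 / (A + 1)) := mul_le_mul_of_nonneg_left hδ₀A hA0
    have h3 : A * (3 / 4 * m₀ ^ 4 / (A + 1)) < 3 / 4 * m₀ ^ 4 := by
      rw [mul_div_assoc', div_lt_iff₀ (by positivity)]
      have hm : 0 < 3 / 4 * m₀ ^ 4 := by positivity
      nlinarith
    linarith
  linarith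

/-- **Minkowski space satisfies the windowed, boost-bounded collar-margin clause — vacuously, at order
`k₁ = 2`.** For every label window `m₀ > 0` and boost bound `ρ₀` there are `χ₁ = 0 < 1`, `k₁ = 2`,
`δ₁ > 0` and `K₁ = ∅` such that every thick Kerr collar chart of Minkowski space with windowed label and
`max(‖Λ‖, ‖Λ⁻¹‖) ≤ ρ₀` which is `δ₁`-quiet in `C²` on its slab has `|a₁| ≤ χ₁ M₁` — because no such chart
exists (`minkowski_truncDeviationCk_gt_of_window`). This is the body of the candidate restatement C‴ of
crux `GenericCensorshipCollarMargin` (stmt-FinalStateConjecture-10809, `RestatementProbeC3.lean` with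
`boostNorm := max ‖Λ‖ ‖Λ⁻¹‖`) read for Minkowski spacetime: the RESTATED clause is junk-free in flat
space (whereas the filed, un-windowed clause is violated there by the Nash–Kuiper junk at `M₁ → ∞`).
[cite: arXiv07060622, §3] -/
theorem minkowski_windowedCollarMargin_of_kretschmann
    (hQ : Kerr.kretschmannScalar_closedForm)
    {m₀ : ℝ} (hm₀ : 0 < m₀) (ρ₀ : ℝ) :
    ∃ (χ₁ : ℝ) (k₁ : ℕ) (δ₁ : ENNReal) (K₁ : Set Minkowski.spacetime.carrier), χ₁ < 1 ∧ 0 < δ₁ ∧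
      IsCompact K₁ ∧
      ∀ (M₁ a₁ : ℝ) (mo₁ : lorentzGroup × E4) (B₁ : ModelBackground)
        (Φ₁ : B₁.domain → Minkowski.spacetime.carrier),
        m₀ ≤ M₁ → M₁ ≤ m₀⁻¹ →
        max ‖((mo₁.1 : E4 ≃L[ℝ] E4) : E4 →L[ℝ] E4)‖ ‖((mo₁.1 : E4 ≃L[ℝ] E4).symm : E4 →L[ℝ] E4)‖ ≤ ρ₀ →
        |a₁| ≤ M₁ →
        B₁ = starBackground mo₁.1 mo₁.2 M₁ a₁ (fun x => Kerr.radius a₁ (poincareInv mo₁.1 mo₁.2 x)) →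
        ContMDiffOn 𝓘(ℝ, E4) (𝓡 4) ((⊤ : ℕ∞) : WithTop ℕ∞) Φ₁
          {x | -1 < B₁.time x.1 ∧ B₁.time x.1 < 1 ∧ B₁.radius x.1 < 3 * M₁ + 1} →
        Topology.IsOpenEmbedding
          ({x | -1 < B₁.time x.1 ∧ B₁.time x.1 < 1 ∧ B₁.radius x.1 < 3 * M₁ + 1}.restrict Φ₁) →
        Minkowski.spacetime.truncDeviationCk B₁ Φ₁ k₁ (3 * M₁) 0 ≤ δ₁ →
        Disjoint (Φ₁ '' B₁.truncTimeSlab (3 * M₁) 0)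
          (Minkowski.spacetime.metric.causalPast Minkowski.spacetime.timeOrientation K₁) →
        |a₁| ≤ χ₁ * M₁ := by
  obtain ⟨δ₀, hδ₀, H⟩ := minkowski_truncDeviationCk_gt_of_window hQ hm₀ ρ₀
  refine ⟨0, 2, ENNReal.ofReal δ₀, ∅, zero_lt_one, ENNReal.ofReal_pos.2 hδ₀, isCompact_empty, ?_⟩
  intro M₁ a₁ mo₁ B₁ Φ₁ hlo hhi hmo ha hB hΦ _ hdev _
  have h := H M₁ a₁ mo₁.1 mo₁.2 B₁ Φ₁ hlo hhi ha ((le_max_left _ _).trans hmo) ((le_max_right _ _).trans hmo)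
    hB hΦ
  exact absurd hdev (not_le.2 h)

end Main

end KerrWindow

end Literature.Geometry.Lorentzian

end
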